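import Summits.ResolutionOfSingularities.ResolutionOfSingularities.Theorems.NearCutCompanion3
import HarnessLib

/-!
# NearCutWalls — decomp-res node «NearCut» (lens-3 g22, critic row 170), tree file 7/10 of the node

Content VERBATIM from the decomp-res lens-3 g22 node `HOME/decomp-res-lens-3/g22/NearCut.lean` (pin 52e91527; HOME =
run/shared/lean/pub/decomp-res); critic row 170
BOOKED 0·0; landing orders INBOX :715 / :727 — provenance, critic text and the lens header in full in the first file
of the node, `NearCutForms`.  Namespace
`…Theorems.NearCut`; `--supports stmt-ResolutionOfSingularities-31770`; linear import chain in the lens's order.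

## This file

§N5 WALL EXCLUSION (kernel: `topIdeal q F_t ⊆ multIdeal s G_n + (y_w)` for each wall by the higher Leibniz rule;
`OffWallShedding`, `sheddingLemma_of_offWall`, `isolatedMult_of_walls` — sections `HasseGeneric`, `HasseWall`,
`WalkWalls`), §N5b the wall transition `walls_succ` under a δ-balanced move (`section WallSucc`), §N5c the walk-free
form `ChainShedding` of the shedding target + reductions (`section Chain`).  (This first part carries:
`hasseDeriv_X_pow_eq_zero`, `isQPoly_taylor`, `hasseDeriv_eq_zero_of_isQPoly`, `topIdeal_le_multIdeal_sup_wall`,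
`wallIsolated_of_structure`, `mul_pow_mem_of_le`, `isolatedMult_of_walls`, `wallIsolation`.)

[WRITER NOTE (decomp-res writer g10): file split only (tree files ≤ 400 lines); namespace blocks, sections, section
variables, `open` lines and every declaration
exactly as in the lens; the three deprecated `Finsupp.degree_add` occurrences read `map_add` (definitionally the same lemma).]

(Sources: cossart2020 (Cossart–Jannsen–Saito LNM 2270: Thm 5.40 p. 85, Defs 5.38/5.39 pp. 84–85, Thm 5.28 p. 72, Thm
5.35 / Cor 5.37); HauserPerlega2024 (Prop. 3 p. 791); Hauser2010Kangaroo (arXiv:0811.4151); Moh1987;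
CossartPiltant2008 §2; Giraud1975; Hironaka1964.)
-/

noncomputable section

open MvPolynomial Finset
open Literature.AlgebraicGeometry.Resolution
open Literature.AlgebraicGeometry.Resolution.Hauser2010
open Literature.AlgebraicGeometry.Resolution.PointBlowup
open Summit.ResolutionOfSingularities.ResolutionOfSingularities.Theses
open Summit.ResolutionOfSingularities.ResolutionOfSingularities.Theorems.TightDefectClasses
open Summit.ResolutionOfSingularities.ResolutionOfSingularities.Theorems.TightDefectStrongWalks
open Summit.ResolutionOfSingularities.ResolutionOfSingularities.Theorems.ItineraryCutClasses
open Summit.ResolutionOfSingularities.ResolutionOfSingularities.Theorems.BoundaryLedger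
open Summit.ResolutionOfSingularities.ResolutionOfSingularities.Theorems.ProximityCut
open Summit.ResolutionOfSingularities.ResolutionOfSingularities.Theorems.ConeCutAxisLaw
open Literature.AlgebraicGeometry.Resolution.WeightedBlowup
open Literature.Barriers.ResolutionOfSingularities
open Summit.ResolutionOfSingularities.ResolutionOfSingularities.Theorems.FloorCut
open Summit.ResolutionOfSingularities.ResolutionOfSingularities.Theorems.ConeCut
open Summit.ResolutionOfSingularities.ResolutionOfSingularities.Theorems.ExitLaw (fin3_cases eq_of_le_of_degree_le)
open Summit.ResolutionOfSingularities.ResolutionOfSingularities.Theorems.ShadeCut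
open Summit.ResolutionOfSingularities.ResolutionOfSingularities.Theorems.TightCut
open Summit.ResolutionOfSingularities.ResolutionOfSingularities.Theorems.HoleCut

namespace Summit.ResolutionOfSingularities.ResolutionOfSingularities.Theorems.NearCut

section HasseGeneric

variable {σ : Type*} {K : Type*} [Field K]

/-! ## §N5  WALL EXCLUSION (kernel) — the half of the shedding lemma that uses the threefold's forcedness

The threefold's own isolation hypothesis (`ForcedWalk.isolated`: the top locus `V(topIdeal q F_t)` is the closed point)
already confines the order-`s` locus of the COMPANION SURFACE `G_n` away from the two WALLS `{y_w = 0}` (`r_t w = δ`):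
by the higher Leibniz rule and `D^α K[y^q] = 0` (`0 < |α| < q`),
  `topIdeal q F_t ⊆ multIdeal s G_n + (y_w)`   for each wall `w`,
because a Hasse derivative `D^β (y_w^δ)` is a multiple of `y_w` unless `β = δ·e_w`, and then the complementary
derivative of order `|α| - δ < q - δ = s` lands in `multIdeal s G_n`.  Consequently the only part of the shedding lemma
that is NOT kernel-proved is the classical OFF-WALL statement `OffWallShedding` (the order-`s` locus of `G_n` lies in the
union of the two walls for `n ≫ 0`), and `SheddingLemma` follows from it by ideal arithmetic (`isolatedMult_of_walls`). -/

/-- `D^β (y_w^n) = 0` unless `β` is a multiple of `e_w`. [folklore; EGA IV 16.11.2] [folklore] -/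
theorem hasseDeriv_X_pow_eq_zero [DecidableEq σ] (w : σ) (n : ℕ) {β : σ →₀ ℕ}
    (hβ : β ≠ Finsupp.single w (β w)) : hasseDeriv K β (X w ^ n : MvPolynomial σ K) = 0 := by
  rw [hasseDeriv_apply, map_pow, taylor_X, add_comm, add_pow, coeff_sum]
  refine Finset.sum_eq_zero fun j _ => ?_
  have hC : (X w : MvPolynomial σ (MvPolynomial σ K)) ^ j * C (X w) ^ (n - j) *
        (n.choose j : MvPolynomial σ (MvPolynomial σ K)) =
      C ((n.choose j : MvPolynomial σ K) * X w ^ (n - j)) * X w ^ j := by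
    rw [map_mul, map_pow, map_natCast]; ring
  rw [hC, coeff_C_mul, coeff_X_pow, if_neg, mul_zero]
  intro h
  apply hβ
  rw [← h, Finsupp.single_eq_same]

/-- The Taylor expansion of a `q`-polynomial is a `q`-polynomial in the increments (`q = p^e`, characteristic `p`):
`(x + u)^{qk} = (x^q + u^q)^k`. [folklore] -/
theorem isQPoly_taylor [DecidableEq σ] {p : ℕ} [hp : Fact p.Prime] [CharP K p] (e : ℕ) {P : MvPolynomial σ K}
    (hP : IsQPoly (p ^ e) P) : IsQPoly (p ^ e) (taylor K P) := by
  have hsum : taylor K P = ∑ d ∈ P.support, taylor K (monomial d (coeff d P)) := by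
    conv_lhs => rw [P.as_sum]
    rw [map_sum]
  rw [hsum]
  refine IsQPoly.sum _ fun d hd => ?_
  rw [taylor, aeval_monomial, MvPolynomial.algebraMap_apply, MvPolynomial.algebraMap_eq]
  refine (isQPoly_C _ _).mul ?_
  unfold Finsupp.prod
  refine IsQPoly.prod _ fun i hi => ?_
  obtain ⟨k, hk⟩ := hP d (mem_support_iff.mp hd) i
  show IsQPoly (p ^ e) ((C (X i) + X i) ^ (d i))
  rw [hk, pow_mul, add_pow_char_pow, ← map_pow]
  exact ((isQPoly_C _ _).add (isQPoly_X_pow _ _)).pow _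

/-- **Hasse derivatives of non-`q`-divisible order kill `K[y^q]`**: `D^α C = 0` for `C ∈ K[y^q]` whenever some `α_i` is
not divisible by `q = p^e`. [folklore; Hironaka's differential characterisation of `K[y^q]`] [folklore] -/
theorem hasseDeriv_eq_zero_of_isQPoly [DecidableEq σ] {p : ℕ} [Fact p.Prime] [CharP K p] (e : ℕ)
    {P : MvPolynomial σ K} (hP : IsQPoly (p ^ e) P) {α : σ →₀ ℕ} (hα : ∃ i, ¬ p ^ e ∣ α i) :
    hasseDeriv K α P = 0 := by
  obtain ⟨i, hi⟩ := hα
  rw [hasseDeriv_apply]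
  by_contra h
  exact hi (isQPoly_taylor e hP α h i)

end HasseGeneric

section HasseWall

variable {K : Type} [Field K]

/-- **WALL INCLUSION.**  For `F = y^r·U·G + C_q` with `C_q ∈ K[y^q]`, `q = p^e = δ + s`, and a wall `w` (`r_w = δ > 0`):
`topIdeal q F ⊆ multIdeal s G + (y_w)`. [new; higher Leibniz rule + `D^α K[y^q] = 0`] [folklore] -/
theorem topIdeal_le_multIdeal_sup_wall {p e : ℕ} (hp : p.Prime) [CharP K p] {δ s : ℕ} (hδs : δ + s = p ^ e)
    {F U G Cq : MvPolynomial (Fin 3) K} {r : Fin 3 →₀ ℕ} (hCq : IsQPoly (p ^ e) Cq)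
    (hF : F = monomial r 1 * U * G + Cq) {w : Fin 3} (hw : r w = δ) :
    topIdeal (p ^ e) F ≤ multIdeal s G ⊔ Ideal.span {X w} := by
  classical
  haveI := Fact.mk hp
  unfold topIdeal
  rw [Ideal.span_le]
  rintro _ ⟨α, ⟨hα0, hαq⟩, rfl⟩
  have hmono : monomial r (1 : K) = X w ^ δ * monomial (r.erase w) 1 := by
    rw [X_pow_eq_monomial, monomial_mul, one_mul, ← hw, Finsupp.single_add_erase]
  have hsplit : monomial r (1 : K) * U * G = X w ^ δ * (monomial (r.erase w) 1 * U * G) := by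
    rw [hmono]; ring
  have hCq0 : hasseDeriv K α Cq = 0 := by
    apply hasseDeriv_eq_zero_of_isQPoly e hCq
    obtain ⟨i, hi⟩ : ∃ i, α i ≠ 0 := by
      by_contra hcon
      push Not at hcon
      exact hα0 (Finsupp.ext hcon)
    refine ⟨i, fun hdiv => ?_⟩
    have h1 := Nat.le_of_dvd (Nat.pos_of_ne_zero hi) hdiv
    have h2 : α i ≤ α.degree := Finsupp.le_degree i α
    omega
  show hasseDeriv K α F ∈ _
  rw [hF, map_add, hCq0, add_zero, hsplit, hasseDeriv_mul]
  refine Ideal.sum_mem _ fun βγ hβγ => ?_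
  have hsum : βγ.1 + βγ.2 = α := Finset.HasAntidiagonal.mem_antidiagonal.mp hβγ
  by_cases hβ : βγ.1 = Finsupp.single w (βγ.1 w)
  · by_cases hk : βγ.1 w < δ
    · -- `D^β (y_w^δ) = (δ choose k)·y_w^{δ-k} ∈ (y_w)`
      apply Ideal.mem_sup_right
      refine Ideal.mul_mem_right _ _ ?_
      rw [hβ, hasseDeriv_X_pow]
      refine Ideal.mul_mem_left _ _ (Ideal.mem_span_singleton.mpr (dvd_pow_self _ (by omega)))
    · -- `|γ| < s`: `D^γ (y^{r'} U · G) ∈ multIdeal s G`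
      apply Ideal.mem_sup_left
      refine Ideal.mul_mem_left _ _ ?_
      have hγ : βγ.2.degree < s := by
        have h1 : βγ.1.degree = βγ.1 w := by rw [hβ, Finsupp.degree_single, Finsupp.single_eq_same]
        have h2 : α.degree = βγ.1.degree + βγ.2.degree := by rw [← hsum, map_add]
        omega
      rw [hasseDeriv_mul]
      refine Ideal.sum_mem _ fun βγ' hβγ' => Ideal.mul_mem_left _ _ (Ideal.subset_span ⟨βγ'.2, ?_, rfl⟩)
      have hsum' : βγ'.1 + βγ'.2 = βγ.2 := Finset.HasAntidiagonal.mem_antidiagonal.mp hβγ'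
      show βγ'.2.degree < s
      have : βγ.2.degree = βγ'.1.degree + βγ'.2.degree := by rw [← hsum', map_add]
      omega
  · rw [hasseDeriv_X_pow_eq_zero w δ hβ, zero_mul]
    exact Ideal.zero_mem _

/-- **WALL EXCLUSION (one stage).**  If moreover the top locus of `F` is the closed point (`IsolatedTop q F`), then the
order-`s` locus of `G` meets the wall `{y_w = 0}` only at the closed point:
`∃ M g, g(0) ≠ 0 ∧ g·y_i^M ∈ multIdeal s G + (y_w)` for all `i`. [new] [folklore] -/
theorem wallIsolated_of_structure {p e : ℕ} (hp : p.Prime) [CharP K p] {δ s : ℕ} (hδs : δ + s = p ^ e)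
    {F U G Cq : MvPolynomial (Fin 3) K} {r : Fin 3 →₀ ℕ} (hCq : IsQPoly (p ^ e) Cq)
    (hF : F = monomial r 1 * U * G + Cq) {w : Fin 3} (hw : r w = δ) (hiso : IsolatedTop (p ^ e) F) :
    ∃ (M : ℕ) (g : MvPolynomial (Fin 3) K), constantCoeff g ≠ 0 ∧
      ∀ i, g * X i ^ M ∈ multIdeal s G ⊔ Ideal.span {X w} := by
  obtain ⟨M, g, hg, hmem⟩ := hiso
  exact ⟨M, g, hg, fun i => topIdeal_le_multIdeal_sup_wall hp hδs hCq hF hw (hmem i)⟩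

/-- Padding an isolation exponent. [folklore] -/
theorem mul_pow_mem_of_le {R : Type*} [CommRing R] {I : Ideal R} {g x : R} {a b : ℕ} (h : g * x ^ a ∈ I)
    (hab : a ≤ b) : g * x ^ b ∈ I := by
  rw [← pow_mul_pow_sub x hab, ← mul_assoc]
  exact Ideal.mul_mem_right _ _ h

/-- **GLUE (ideal arithmetic).**  Isolation modulo each of two walls + confinement to the union of the walls ⇒ isolation:
if `g₁ y_i^M ∈ I + (y_{w₁})`, `g₂ y_i^M ∈ I + (y_{w₂})` for all `i` and `g₃ (y_{w₁} y_{w₂})^M ∈ I`, then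
`g₃ (g₁ g₂)^M · y_i^{2M·M} ∈ I` for all `i`. [new; elementary] [folklore] -/
theorem isolatedMult_of_walls {R : Type*} [CommRing R] {I : Ideal R} {y₁ y₂ : R} {M : ℕ} {g₁ g₂ g₃ : R}
    (x : R) (h1 : g₁ * x ^ M ∈ I ⊔ Ideal.span {y₁}) (h2 : g₂ * x ^ M ∈ I ⊔ Ideal.span {y₂})
    (h3 : g₃ * (y₁ * y₂) ^ M ∈ I) : g₃ * (g₁ * g₂) ^ M * x ^ (2 * M * M) ∈ I := by
  obtain ⟨a₁, ha₁, b₁, hb₁, hab₁⟩ := Submodule.mem_sup.mp h1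
  obtain ⟨a₂, ha₂, b₂, hb₂, hab₂⟩ := Submodule.mem_sup.mp h2
  obtain ⟨c₁, rfl⟩ := Ideal.mem_span_singleton'.mp hb₁
  obtain ⟨c₂, rfl⟩ := Ideal.mem_span_singleton'.mp hb₂
  -- `g₁ g₂ x^{2M} = A + (y₁ y₂)(c₁ c₂)` with `A ∈ I`
  set A : R := a₁ * a₂ + a₁ * (c₂ * y₂) + c₁ * y₁ * a₂ with hA
  have hAI : A ∈ I := by
    refine I.add_mem (I.add_mem (I.mul_mem_right _ ha₁) (I.mul_mem_right _ ha₁)) (I.mul_mem_left _ ha₂)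
  have hprod : g₁ * g₂ * x ^ (2 * M) = A + y₁ * y₂ * (c₁ * c₂) := by
    have : g₁ * g₂ * x ^ (2 * M) = (g₁ * x ^ M) * (g₂ * x ^ M) := by ring
    rw [this, ← hab₁, ← hab₂, hA]; ring
  -- `(A + z)^M - z^M ∈ (A) ⊆ I`
  obtain ⟨d, hd⟩ := sub_dvd_pow_sub_pow (A + y₁ * y₂ * (c₁ * c₂)) (y₁ * y₂ * (c₁ * c₂)) M
  have hpow : (g₁ * g₂ * x ^ (2 * M)) ^ M = (y₁ * y₂ * (c₁ * c₂)) ^ M + (A + y₁ * y₂ * (c₁ * c₂) - y₁ * y₂ * (c₁ * c₂)) * d := by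
    rw [hprod, ← hd]; ring
  have hfin : g₃ * (g₁ * g₂) ^ M * x ^ (2 * M * M) = g₃ * (g₁ * g₂ * x ^ (2 * M)) ^ M := by ring
  rw [hfin, hpow, mul_add, add_sub_cancel_right]
  refine I.add_mem ?_ ?_
  · have : g₃ * (y₁ * y₂ * (c₁ * c₂)) ^ M = g₃ * (y₁ * y₂) ^ M * (c₁ * c₂) ^ M := by ring
    rw [this]
    exact I.mul_mem_right _ h3
  · have : g₃ * (A * d) = A * (g₃ * d) := by ring
    rw [this]
    exact I.mul_mem_right _ hAI

end HasseWall

section WalkWalls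

variable {K : Type} [Field K] [PerfectField K] [DecidableEq K]

omit [PerfectField K] in
/-- **WALL ISOLATION ALONG A δ-BALANCED PLATEAU (kernel).**  At every stage `N + n` and for every wall `w`
(`r_{N+n} w = q - s`), the order-`s` locus of the companion `G_n` meets `{y_w = 0}` only at the closed point — from the
threefold's forcedness `ForcedWalk.isolated` through the structure invariant `F_{N+n} = y^r U G_n + C_q`. [new] [folklore] -/
theorem wallIsolation {p e : ℕ} (hp : p.Prime) [CharP K p] {s₀ : State (Fin 3) K} (hroot : IsRoot (p ^ e) s₀)
    (W : ForcedWalk (p ^ e) s₀) (N : ℕ) (hplat : ∀ t, N ≤ t → (W.st (t + 1)).shade = (W.st t).shade)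
    (hbig : ∀ t, N ≤ t → ordZero (W.st t).F ≠ ((p ^ e : ℕ) : ℕ∞)) (s : ℕ) (hs : (W.st N).shade = (s : ℕ∞))
    (hbal : ∀ t, N ≤ t → ((W.st t).r.degree + 2 * s = 2 * p ^ e ∧
      ∃ x, (W.st t).r x = 0 ∧ ∀ y, y ≠ x → (W.st t).r y + s = p ^ e))
    (n : ℕ) (w : Fin 3) (hw : (W.st (N + n)).r w = p ^ e - s) :
    ∃ (M : ℕ) (g : MvPolynomial (Fin 3) K), constantCoeff g ≠ 0 ∧
      ∀ i, g * X i ^ M ∈ multIdeal s (companion W N s n) ⊔ Ideal.span {X w} := by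
  classical
  obtain ⟨U, Cq, hU, hCq, hF, hord⟩ := tailInv_of_balanced hp hroot W N hplat hbig s hs hbal n
  have hsq : s < p ^ e := lt_of_balanced hroot W (N + n) s (shade_of_plateau W N s hplat hs (N + n) (by omega))
    (hbig _ (by omega)) (hbal _ (by omega)).1
  exact wallIsolated_of_structure hp (δ := p ^ e - s) (by omega) hCq hF hw (W.isolated (N + n))

end WalkWalls

end Summit.ResolutionOfSingularities.ResolutionOfSingularities.Theorems.NearCut
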